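/- Width seat `ym-line-sfw-p2-w5` (prover-ym-line-sfw-p2-w5-g18-0), free hands on planner ym-idea-2 g16's LINE-19 task board (STUB-PLAN-S4b §10,
the FREE item T5 = the S4b assembly; crux `AllWindowsColdBox.BoxHighWindowsSU22` = stmt-QuantumFields-24004 / 24335, stub S4b):
the one-step bootstrap assembled — S4b `LandauBootstrapBound` from S3b `LandauKernelDecay` alone. -/
import Summits.QuantumFields.YangMills.Theorems.AllWindowsColdBoxBoxHighLineBootstrapErrorSum
import Summits.QuantumFields.YangMills.Theorems.AllWindowsColdBoxBoxHighLineCaccioppoliThree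
import Summits.QuantumFields.YangMills.Theorems.AllWindowsColdBoxBoxHighLineVarianceBounded

/-!
# LINE-19 S4b: the one-step bootstrap — `LandauKernelDecay → LandauBootstrapBound` (T5 assembled)

STUB-PLAN-S4b §10 T5, assembled from the landed bricks: Stage I with the total defect (✓`exists_landau_total`, hemisphere ✓`stageI_defect_le_one`),
divergence-free su(2)-coordinates in Landau gauge (✓`gradVec_dotProduct_imVec_eq_zero_of_inLandauGauge`), the Hodge representation
(✓`hodgeRepresentation′`), the circulation = signed link sum (✓`landauCoeff_dotProduct_imVec_gaugeTransform`) controlled by the holonomy through the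
quaternion BCH estimate (✓`quaternionBCH`, ✓`abs_circulation_sub_imVec_holonomy_le`, ✓`abs_imVec_holonomy_gaugeTransform_le`), the row sum H4b.1
from S3 (✓`h4b1one_of_S3` with the tree's ✓`landauVarianceBounded`), the ℓ² row (✓`gradKernelL2`) and the summed BCH error by Cauchy–Schwarz against
the total defect (✓`sq_sum_abs_mul_linkSum_le`).  With `m` the largest su(2)-coordinate over the cold-box links of the Stage-I representative `W`:
`m ≤ C_K·H(1+log H)·s + C₁·C_b·(1+log H)H⁴s·m`, and the premise `s·H⁴(1+log H)² ≤ c₀` with `c₀` small absorbs the second term: `m ≤ 2C_K H(1+log H) s`,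
whence every link defect is `≤ 6m² ≤ 24C_K²·H²(1+log H)²·s²`.

Result: **`landauBootstrapBound_of_landauKernelDecay : LandauKernelDecay → LandauBootstrapBound`** — the registered stub S4b
(`stub_landauRepresentative : LandauBootstrapBound`, skeleton v11) now follows from the second conjunct S3b of the registered stub S3 ALONE; with
✓`gaugeBallReduction_of_landauRepresentative` so does S4.  Everything proved; no definition; standard axioms.  HONEST LABEL: a CONDITIONAL
reduction between registered stubs of a critic-PASSed line on the R2ξ″ RECORD-rung crux 24004 / 24335 — S3b `LandauKernelDecay` is OPEN, so neither
S4b nor S4 is closed by this file; no crux, rung or summit is proved; the Yang–Mills mass gap is NOT proved by this file.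
-/

set_option autoImplicit false

noncomputable section

open Finset Matrix
open Literature.MathematicalPhysics.QuantumFieldTheory hiding boxEdges
open Literature.MathematicalPhysics.QuantumFieldTheory.LatticeMaxwell
open Literature.MathematicalPhysics.QuantumFieldTheory.AxialGauge
open Summit.QuantumFields.YangMills.Theorems.WeakCouplingRates
open Literature.Probability.LatticeModels (Site)
open Literature.MathematicalPhysics.QuantumLattice (LGConfig gaugeTransformZd plaquetteHolonomyZd fundamentalRep)

namespace Summit.QuantumFields.YangMills.Theorems.AllWindowsColdBoxBoxHighLine

/-- The edge `((0,…,0), 0)` is a cold-box edge (`H ≥ 1`), so the cold box has links. -/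
theorem zero_mem_boxEdges {H : ℕ} (hH : 1 ≤ H) :
    (((fun _ => (0 : ℤ)) : Site 4), (0 : Fin 4)) ∈ boxEdges 4 (2 * H + 1) := by
  rw [mem_boxEdges_iff]
  refine ⟨fun k => ⟨le_rfl, ?_⟩, ?_⟩
  · push_cast; omega
  · push_cast; omega

/-- Real arithmetic of the smallness step: the premise `s·H⁴·L² ≤ c₀` with `c₀ ≤ 1/(2C₁'C_b+2)` makes the error coefficient `≤ 1/2`. -/
theorem bootstrap_smallness {C₁' Cb c₀ L H4 s : ℝ} (hC : 0 ≤ C₁') (hCb : 0 < Cb) (hc₀ : c₀ ≤ 1 / (2 * C₁' * Cb + 2))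
    (hL : 1 ≤ L) (hH4 : 0 ≤ H4) (hs : 0 ≤ s) (hprem : s * H4 * L ^ 2 ≤ c₀) :
    C₁' * Cb * (L * H4 * s) ≤ 1 / 2 := by
  have h0 : 0 ≤ s * H4 := mul_nonneg hs hH4
  have hLL : L ≤ L ^ 2 := by nlinarith
  have hp0 : s * H4 * L ≤ s * H4 * L ^ 2 := mul_le_mul_of_nonneg_left hLL h0
  have hp1 : L * H4 * s ≤ c₀ := by linarith
  have hpos : (0 : ℝ) < 2 * C₁' * Cb + 2 := by positivity
  have hCC : 0 ≤ C₁' * Cb := mul_nonneg hC hCb.le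
  calc C₁' * Cb * (L * H4 * s) ≤ C₁' * Cb * c₀ := mul_le_mul_of_nonneg_left hp1 hCC
    _ ≤ C₁' * Cb * (1 / (2 * C₁' * Cb + 2)) := mul_le_mul_of_nonneg_left hc₀ hCC
    _ = (C₁' * Cb) / (2 * C₁' * Cb + 2) := by ring
    _ ≤ 1 / 2 := by rw [div_le_iff₀ hpos]; nlinarith

/-- Real arithmetic of the final step: `defect ≤ 6m²`, `m ≤ 2·C_K·H·L·s`, `L ≥ 1` give `defect ≤ (24C_K²+1)·H²·L⁴·s²`. -/
theorem bootstrap_defect_bound {D m CK Hr L s : ℝ} (hD : D ≤ 6 * m ^ 2) (hm0 : 0 ≤ m) (hm : m ≤ 2 * (CK * Hr * L * s))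
    (hL : 1 ≤ L) : D ≤ (24 * CK ^ 2 + 1) * Hr ^ 2 * L ^ 4 * s ^ 2 := by
  have hmsq : m ^ 2 ≤ (2 * (CK * Hr * L * s)) ^ 2 := pow_le_pow_left₀ hm0 hm 2
  have hL2 : L ^ 2 ≤ L ^ 4 := by
    have : 1 ≤ L ^ 2 := one_le_pow₀ hL
    nlinarith
  have hX : 0 ≤ CK ^ 2 * Hr ^ 2 * s ^ 2 := by positivity
  have hY : 0 ≤ Hr ^ 2 * L ^ 4 * s ^ 2 := by positivity
  calc D ≤ 6 * m ^ 2 := hD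
    _ ≤ 6 * (2 * (CK * Hr * L * s)) ^ 2 := by linarith
    _ = 24 * (CK ^ 2 * Hr ^ 2 * s ^ 2) * L ^ 2 := by ring
    _ ≤ 24 * (CK ^ 2 * Hr ^ 2 * s ^ 2) * L ^ 4 := mul_le_mul_of_nonneg_left hL2 (by positivity)
    _ ≤ (24 * CK ^ 2 + 1) * Hr ^ 2 * L ^ 4 * s ^ 2 := by nlinarith

/-- **The summed BCH error is `≤ C_b·(1+log H)·H⁴·s`** (Cauchy–Schwarz ✓`sq_sum_abs_mul_linkSum_le`, the ℓ²-row bound and the total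
Stage-I defect). -/
theorem summed_error_le {H : ℕ} {U : LGConfig 4 SU2} (hU : ColdWall H U) {g : Site 4 → SU2} (hg : IsInteriorGauge H g)
    {s : ℝ} (hs : 0 ≤ s) (htot : ∑ e ∈ boxEdges 4 (2 * H + 1), linkDefect (gaugeTransformZd g U) e ≤ 72900 * (H : ℝ) ^ 8 * s ^ 2)
    (e₀ : LandauFree H) {C2' : ℝ} (hC2'0 : 0 ≤ C2')
    (hK2' : ∑ p ∈ hodgePlaqs H, (((hodgeQ H)⁻¹ *ᵥ landauCoeff H p) e₀) ^ 2 ≤ C2' * (1 + Real.log H) ^ 2) :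
    ∑ p ∈ hodgePlaqs H, |((hodgeQ H)⁻¹ *ᵥ landauCoeff H p) e₀| * ∑ k : Fin 4, ∑ c' : Fin 3,
        |imVec ((![gaugeTransformZd g U (p.1, p.2.1), gaugeTransformZd g U (p.1 + Pi.single p.2.1 1, p.2.2),
          gaugeTransformZd g U (p.1 + Pi.single p.2.2 1, p.2.1), gaugeTransformZd g U (p.1, p.2.2)] : Fin 4 → SU2) k) c'| ≤
      (C2' * 13996800 + 1) * (1 + Real.log H) * (H : ℝ) ^ 4 * s := by
  have hsq := sq_sum_abs_mul_linkSum_le hU hg (fun p => ((hodgeQ H)⁻¹ *ᵥ landauCoeff H p) e₀)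
  have hL0 : 0 ≤ 1 + Real.log (H : ℝ) := by have := Real.log_natCast_nonneg H; linarith
  have hB0 : 0 ≤ (C2' * 13996800 + 1) * (1 + Real.log H) * (H : ℝ) ^ 4 * s := by positivity
  have htot0 : 0 ≤ ∑ e ∈ boxEdges 4 (2 * H + 1), linkDefect (gaugeTransformZd g U) e :=
    Finset.sum_nonneg fun e _ => linkDefect_nonneg _ e
  have hprod : (∑ p ∈ hodgePlaqs H, (((hodgeQ H)⁻¹ *ᵥ landauCoeff H p) e₀) ^ 2) *
      (192 * ∑ e ∈ boxEdges 4 (2 * H + 1), linkDefect (gaugeTransformZd g U) e) ≤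
      ((C2' * 13996800 + 1) * (1 + Real.log H) * (H : ℝ) ^ 4 * s) ^ 2 := by
    calc (∑ p ∈ hodgePlaqs H, (((hodgeQ H)⁻¹ *ᵥ landauCoeff H p) e₀) ^ 2) *
          (192 * ∑ e ∈ boxEdges 4 (2 * H + 1), linkDefect (gaugeTransformZd g U) e)
        ≤ (C2' * (1 + Real.log H) ^ 2) * (192 * (72900 * (H : ℝ) ^ 8 * s ^ 2)) :=
          mul_le_mul hK2' (mul_le_mul_of_nonneg_left htot (by norm_num)) (by positivity) (by positivity)
      _ ≤ ((C2' * 13996800 + 1) * (1 + Real.log H) * (H : ℝ) ^ 4 * s) ^ 2 := by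
          have hX : 0 ≤ C2' * 13996800 := by positivity
          have hY : 0 ≤ ((1 + Real.log (H : ℝ)) * (H : ℝ) ^ 4 * s) ^ 2 := sq_nonneg _
          nlinarith
  have hS0 : 0 ≤ ∑ p ∈ hodgePlaqs H, |((hodgeQ H)⁻¹ *ᵥ landauCoeff H p) e₀| * ∑ k : Fin 4, ∑ c' : Fin 3,
        |imVec ((![gaugeTransformZd g U (p.1, p.2.1), gaugeTransformZd g U (p.1 + Pi.single p.2.1 1, p.2.2),
          gaugeTransformZd g U (p.1 + Pi.single p.2.2 1, p.2.1), gaugeTransformZd g U (p.1, p.2.2)] : Fin 4 → SU2) k) c'| :=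
    Finset.sum_nonneg fun p _ => mul_nonneg (abs_nonneg _)
      (Finset.sum_nonneg fun _ _ => Finset.sum_nonneg fun _ _ => abs_nonneg _)
  exact (pow_le_pow_iff_left₀ hS0 hB0 (by norm_num : (2 : ℕ) ≠ 0)).1 (hsq.trans hprod)

/-- **The one-step bootstrap (STUB-PLAN-S4b §10 T5): S3b ⇒ S4b.** -/
theorem landauBootstrapBound_of_landauKernelDecay (hDec : LandauKernelDecay) : LandauBootstrapBound := by
  obtain ⟨C₁, hC₁⟩ : QuaternionBCH := quaternionBCH
  obtain ⟨CK, hK⟩ := h4b1one_of_S3 hDec landauVarianceBounded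
  obtain ⟨C2, hK2⟩ := gradKernelL2
  obtain ⟨C₁', hC₁'0, hC₁'⟩ : ∃ C : ℝ, 0 ≤ C ∧ C₁ ≤ C := ⟨max C₁ 0, le_max_right _ _, le_max_left _ _⟩
  obtain ⟨CK', hCK'0, hCK'⟩ : ∃ C : ℝ, 0 ≤ C ∧ CK ≤ C := ⟨max CK 0, le_max_right _ _, le_max_left _ _⟩
  obtain ⟨C2', hC2'0, hC2'⟩ : ∃ C : ℝ, 0 ≤ C ∧ C2 ≤ C := ⟨max C2 0, le_max_right _ _, le_max_left _ _⟩
  obtain ⟨Cb, hCb⟩ : ∃ C : ℝ, C = C2' * 13996800 + 1 := ⟨_, rfl⟩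
  have hCb0 : 0 < Cb := by rw [hCb]; positivity
  obtain ⟨c₀, hc₀⟩ : ∃ c : ℝ, c = min (1 / 270) (1 / (2 * C₁' * Cb + 2)) := ⟨_, rfl⟩
  have hc₀pos : 0 < c₀ := by rw [hc₀]; exact lt_min (by norm_num) (by positivity)
  have hc₀270 : c₀ ≤ 1 / 270 := by rw [hc₀]; exact min_le_left _ _
  have hc₀b : c₀ ≤ 1 / (2 * C₁' * Cb + 2) := by rw [hc₀]; exact min_le_right _ _
  refine ⟨24 * CK' ^ 2 + 1, c₀, by positivity, hc₀pos, ?_⟩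
  intro H hH s hs hprem U hU hS
  have hH1 : (1 : ℝ) ≤ H := by exact_mod_cast hH
  have hL1 : 1 ≤ 1 + Real.log (H : ℝ) := by have := Real.log_nonneg hH1; linarith
  have hL0 : 0 ≤ 1 + Real.log (H : ℝ) := by linarith
  -- Stage I with the total defect, in the hemisphere
  obtain ⟨g, hg, hLandau, htot, hdef⟩ := exists_landau_total hH hs hU hS
  refine ⟨g, hg, hLandau, ?_⟩
  have h1 : 72900 * (H : ℝ) ^ 8 * s ^ 2 ≤ 1 := stageI_defect_le_one hH hs hc₀270 hprem
  have hre_box : ∀ e ∈ boxEdges 4 (2 * H + 1),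
      (1 : ℝ) / 2 ≤ (((gaugeTransformZd g U e : SU2) : Matrix (Fin 2) (Fin 2) ℂ) 0 0).re :=
    fun e he => half_le_re_of_linkDefect_le_one _ e ((hdef e he).trans h1)
  have hre := re_half_le_gaugeTransform hU hg hre_box
  -- the largest su(2)-coordinate over the cold-box links
  have hne : (boxEdges 4 (2 * H + 1) ×ˢ (Finset.univ : Finset (Fin 3))).Nonempty :=
    ⟨(((fun _ => (0 : ℤ)), (0 : Fin 4)), (0 : Fin 3)), Finset.mem_product.2 ⟨zero_mem_boxEdges hH, Finset.mem_univ _⟩⟩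
  obtain ⟨q₀, hq₀, hmax⟩ := Finset.exists_max_image _
    (fun q : Literature.MathematicalPhysics.QuantumLattice.ZdEdge 4 × Fin 3 => |imVec (gaugeTransformZd g U q.1) q.2|) hne
  obtain ⟨m, hm⟩ : ∃ m : ℝ, m = |imVec (gaugeTransformZd g U q₀.1) q₀.2| := ⟨_, rfl⟩
  have hm0 : 0 ≤ m := by rw [hm]; exact abs_nonneg _
  have hq₀box : q₀.1 ∈ boxEdges 4 (2 * H + 1) := (Finset.mem_product.1 hq₀).1
  have hMbox : ∀ e ∈ boxEdges 4 (2 * H + 1), ∀ c : Fin 3, |imVec (gaugeTransformZd g U e) c| ≤ m := by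
    intro e he c
    rw [hm]
    exact hmax (e, c) (Finset.mem_product.2 ⟨he, Finset.mem_univ c⟩)
  have hM := abs_imVec_gaugeTransform_le hU hg hm0 hMbox
  -- the su(2)-coordinate one-form of coordinate `c₀' := q₀.2` is divergence-free, hence Hodge-represented
  let e₀ : LandauFree H := ⟨⟨q₀.1, mem_boxEdgesAt_of_mem_boxEdges hq₀box⟩, fun h => h hq₀box⟩
  have hdiv : ∀ x ∈ interiorSites H,
      gradVec H x ⬝ᵥ (fun i : LandauFree H => imVec (gaugeTransformZd g U i.1.1) q₀.2) = 0 :=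
    fun x hx => gradVec_dotProduct_imVec_eq_zero_of_inLandauGauge hLandau hx q₀.2
  have hrep := hodgeRepresentation' (fun i : LandauFree H => imVec (gaugeTransformZd g U i.1.1) q₀.2) hdiv e₀
  have he₀ : imVec (gaugeTransformZd g U q₀.1) q₀.2 = (fun i : LandauFree H => imVec (gaugeTransformZd g U i.1.1) q₀.2) e₀ := rfl
  -- the key estimate: `m ≤ CK'·H·L·s + C₁'·Cb·L·H⁴·s · m`
  have hrow : ∑ p ∈ hodgePlaqs H, |((hodgeQ H)⁻¹ *ᵥ landauCoeff H p) e₀| ≤ CK' * (H : ℝ) * (1 + Real.log H) :=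
    (hK H hH e₀).trans (mul_le_mul_of_nonneg_right (mul_le_mul_of_nonneg_right hCK' (Nat.cast_nonneg _)) hL0)
  have hrow0 : 0 ≤ ∑ p ∈ hodgePlaqs H, |((hodgeQ H)⁻¹ *ᵥ landauCoeff H p) e₀| := Finset.sum_nonneg fun _ _ => abs_nonneg _
  -- the summed error `Σ_p |G_p| n_p ≤ Cb·L·H⁴·s`
  have hK2' : ∑ p ∈ hodgePlaqs H, (((hodgeQ H)⁻¹ *ᵥ landauCoeff H p) e₀) ^ 2 ≤ C2' * (1 + Real.log H) ^ 2 :=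
    (hK2 H hH e₀).trans (mul_le_mul_of_nonneg_right hC2' (by positivity))
  have hErr := summed_error_le hU hg hs htot e₀ hC2'0 hK2'
  rw [← hCb] at hErr
  -- per-plaquette circulation bound `|Λ_p| ≤ s + C₁'·m·n_p`
  have hΛ : ∀ p ∈ hodgePlaqs H,
      |landauCoeff H p ⬝ᵥ (fun i : LandauFree H => imVec (gaugeTransformZd g U i.1.1) q₀.2)| ≤
        s + C₁' * m * ∑ k : Fin 4, ∑ c' : Fin 3,
        |imVec ((![gaugeTransformZd g U (p.1, p.2.1), gaugeTransformZd g U (p.1 + Pi.single p.2.1 1, p.2.2),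
          gaugeTransformZd g U (p.1 + Pi.single p.2.2 1, p.2.1), gaugeTransformZd g U (p.1, p.2.2)] : Fin 4 → SU2) k) c'| := by
    intro p hp
    have hc := abs_circulation_sub_imVec_holonomy_le hU hg hC₁ hre hM p q₀.2
    have hh := abs_imVec_holonomy_gaugeTransform_le hU hs hS g hp q₀.2
    have hn0 : 0 ≤ ∑ k : Fin 4, ∑ c' : Fin 3,
        |imVec ((![gaugeTransformZd g U (p.1, p.2.1), gaugeTransformZd g U (p.1 + Pi.single p.2.1 1, p.2.2),
          gaugeTransformZd g U (p.1 + Pi.single p.2.2 1, p.2.1), gaugeTransformZd g U (p.1, p.2.2)] : Fin 4 → SU2) k) c'| :=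
      Finset.sum_nonneg fun _ _ => Finset.sum_nonneg fun _ _ => abs_nonneg _
    have hmono : C₁ * m * ∑ k : Fin 4, ∑ c' : Fin 3,
        |imVec ((![gaugeTransformZd g U (p.1, p.2.1), gaugeTransformZd g U (p.1 + Pi.single p.2.1 1, p.2.2),
          gaugeTransformZd g U (p.1 + Pi.single p.2.2 1, p.2.1), gaugeTransformZd g U (p.1, p.2.2)] : Fin 4 → SU2) k) c'| ≤
        C₁' * m * ∑ k : Fin 4, ∑ c' : Fin 3,
        |imVec ((![gaugeTransformZd g U (p.1, p.2.1), gaugeTransformZd g U (p.1 + Pi.single p.2.1 1, p.2.2),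
          gaugeTransformZd g U (p.1 + Pi.single p.2.2 1, p.2.1), gaugeTransformZd g U (p.1, p.2.2)] : Fin 4 → SU2) k) c'| :=
      mul_le_mul_of_nonneg_right (mul_le_mul_of_nonneg_right hC₁' hm0) hn0
    calc |landauCoeff H p ⬝ᵥ (fun i : LandauFree H => imVec (gaugeTransformZd g U i.1.1) q₀.2)|
        = |(landauCoeff H p ⬝ᵥ (fun i : LandauFree H => imVec (gaugeTransformZd g U i.1.1) q₀.2) -
            imVec (plaquetteHolonomyZd (gaugeTransformZd g U) p.1 p.2.1 p.2.2) q₀.2) +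
            imVec (plaquetteHolonomyZd (gaugeTransformZd g U) p.1 p.2.1 p.2.2) q₀.2| := by rw [sub_add_cancel]
      _ ≤ |landauCoeff H p ⬝ᵥ (fun i : LandauFree H => imVec (gaugeTransformZd g U i.1.1) q₀.2) -
            imVec (plaquetteHolonomyZd (gaugeTransformZd g U) p.1 p.2.1 p.2.2) q₀.2| +
            |imVec (plaquetteHolonomyZd (gaugeTransformZd g U) p.1 p.2.1 p.2.2) q₀.2| := abs_add_le _ _
      _ ≤ C₁ * m * (∑ k : Fin 4, ∑ c' : Fin 3,
        |imVec ((![gaugeTransformZd g U (p.1, p.2.1), gaugeTransformZd g U (p.1 + Pi.single p.2.1 1, p.2.2),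
          gaugeTransformZd g U (p.1 + Pi.single p.2.2 1, p.2.1), gaugeTransformZd g U (p.1, p.2.2)] : Fin 4 → SU2) k) c'|) + s := add_le_add hc hh
      _ ≤ C₁' * m * (∑ k : Fin 4, ∑ c' : Fin 3,
        |imVec ((![gaugeTransformZd g U (p.1, p.2.1), gaugeTransformZd g U (p.1 + Pi.single p.2.1 1, p.2.2),
          gaugeTransformZd g U (p.1 + Pi.single p.2.2 1, p.2.1), gaugeTransformZd g U (p.1, p.2.2)] : Fin 4 → SU2) k) c'|) + s := by linarith [hmono]
      _ = s + C₁' * m * ∑ k : Fin 4, ∑ c' : Fin 3,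
        |imVec ((![gaugeTransformZd g U (p.1, p.2.1), gaugeTransformZd g U (p.1 + Pi.single p.2.1 1, p.2.2),
          gaugeTransformZd g U (p.1 + Pi.single p.2.2 1, p.2.1), gaugeTransformZd g U (p.1, p.2.2)] : Fin 4 → SU2) k) c'| := by ring
  -- the key estimate `m ≤ CK'·H·L·s + C₁'·Cb·(L·H⁴·s)·m`
  have hkey : m ≤ CK' * (H : ℝ) * (1 + Real.log H) * s + (C₁' * Cb * ((1 + Real.log H) * (H : ℝ) ^ 4 * s)) * m := by
    have hrep' := hrep
    change imVec (gaugeTransformZd g U q₀.1) q₀.2 = _ at hrep'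
    have hmval : m = |∑ p ∈ hodgePlaqs H, ((hodgeQ H)⁻¹ *ᵥ landauCoeff H p) e₀ *
        (landauCoeff H p ⬝ᵥ fun i : LandauFree H => imVec (gaugeTransformZd g U i.1.1) q₀.2)| := by rw [hm, hrep']
    calc m = |∑ p ∈ hodgePlaqs H, ((hodgeQ H)⁻¹ *ᵥ landauCoeff H p) e₀ *
          (landauCoeff H p ⬝ᵥ fun i : LandauFree H => imVec (gaugeTransformZd g U i.1.1) q₀.2)| := hmval
      _ ≤ ∑ p ∈ hodgePlaqs H, |((hodgeQ H)⁻¹ *ᵥ landauCoeff H p) e₀ *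
          (landauCoeff H p ⬝ᵥ fun i : LandauFree H => imVec (gaugeTransformZd g U i.1.1) q₀.2)| := Finset.abs_sum_le_sum_abs _ _
      _ ≤ ∑ p ∈ hodgePlaqs H, |((hodgeQ H)⁻¹ *ᵥ landauCoeff H p) e₀| *
          (s + C₁' * m * ∑ k : Fin 4, ∑ c' : Fin 3,
        |imVec ((![gaugeTransformZd g U (p.1, p.2.1), gaugeTransformZd g U (p.1 + Pi.single p.2.1 1, p.2.2),
          gaugeTransformZd g U (p.1 + Pi.single p.2.2 1, p.2.1), gaugeTransformZd g U (p.1, p.2.2)] : Fin 4 → SU2) k) c'|) := by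
          refine Finset.sum_le_sum fun p hp => ?_
          rw [abs_mul]
          exact mul_le_mul_of_nonneg_left (hΛ p hp) (abs_nonneg _)
      _ = s * ∑ p ∈ hodgePlaqs H, |((hodgeQ H)⁻¹ *ᵥ landauCoeff H p) e₀| +
          C₁' * m * ∑ p ∈ hodgePlaqs H, |((hodgeQ H)⁻¹ *ᵥ landauCoeff H p) e₀| * ∑ k : Fin 4, ∑ c' : Fin 3,
        |imVec ((![gaugeTransformZd g U (p.1, p.2.1), gaugeTransformZd g U (p.1 + Pi.single p.2.1 1, p.2.2),
          gaugeTransformZd g U (p.1 + Pi.single p.2.2 1, p.2.1), gaugeTransformZd g U (p.1, p.2.2)] : Fin 4 → SU2) k) c'| := by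
          rw [Finset.mul_sum, Finset.mul_sum, ← Finset.sum_add_distrib]
          exact Finset.sum_congr rfl fun p _ => by ring
      _ ≤ s * (CK' * (H : ℝ) * (1 + Real.log H)) + C₁' * m * (Cb * (1 + Real.log H) * (H : ℝ) ^ 4 * s) :=
          add_le_add (mul_le_mul_of_nonneg_left hrow hs) (mul_le_mul_of_nonneg_left hErr (by positivity))
      _ = CK' * (H : ℝ) * (1 + Real.log H) * s + (C₁' * Cb * ((1 + Real.log H) * (H : ℝ) ^ 4 * s)) * m := by ring
  -- smallness of the premise: `C₁'·Cb·(L·H⁴·s) ≤ 1/2`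
  have hsmall : C₁' * Cb * ((1 + Real.log H) * (H : ℝ) ^ 4 * s) ≤ 1 / 2 :=
    bootstrap_smallness hC₁'0 hCb0 hc₀b hL1 (by positivity) hs hprem
  -- absorb (`m ≤ A + θ·m`, `θ ≤ 1/2` ⇒ `m ≤ 2A`; tree: `…GiorgiKlainermanSzeftel2022.JFloorUses.absorb_of_le_half`, inlined)
  have hm2 : m ≤ 2 * (CK' * (H : ℝ) * (1 + Real.log H) * s) := by nlinarith
  -- the defects
  intro e he
  have hdefect := linkDefect_le_six_mul_sq (gaugeTransformZd g U) e (by linarith [hre_box e he]) (hMbox e he)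
  exact bootstrap_defect_bound hdefect hm0 hm2 hL1

/-- **S4 from S3b** (through S4b): with ✓`gaugeBallReduction_of_landauRepresentative`. -/
theorem gaugeBallReduction_of_landauKernelDecay (hDec : LandauKernelDecay) :
    ∀ θL : ℝ, θL < 1 / 12 → ∃ κ : ℝ, 0 < κ ∧ κ < 1 / 2 - 3 * θL ∧ GaugeBallReduction θL κ :=
  gaugeBallReduction_of_landauRepresentative (landauBootstrapBound_of_landauKernelDecay hDec)

end Summit.QuantumFields.YangMills.Theorems.AllWindowsColdBoxBoxHighLine

end
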